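import Mathlib
import Summits.ResolutionOfSingularities.ResolutionOfSingularities.Theses.HomologicalConductor
import Summits.ResolutionOfSingularities.ResolutionOfSingularities.Theorems.HomologicalConductorStrictDropTowerShape
import Summits.ResolutionOfSingularities.ResolutionOfSingularities.Theorems.HomologicalConductorPersistenceSurfaceTowerDim
import Summits.ResolutionOfSingularities.ResolutionOfSingularities.Theorems.HomologicalConductorPersistenceSurfaceSaturationResidualFour
import Literature.AlgebraicGeometry.Resolution.AffineDomainDimension
import Literature.AlgebraicGeometry.Resolution.ArithmeticalThreefolds
import HarnessLib

/-!
# Rung S-2 `PersistenceSurface` (stmt-ResolutionOfSingularities-19970) — FIRST-STEP REDUCTION: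
# every stage of the canonical tower is stage `0` of another admissible datum, so every conjecture
# of the door is a statement about ONE step `T₀ = loc A → T₁`

Route `ResolutionOfSingularities/HomologicalConductor`, chain W4.4b, rung S-2 `PersistenceSurface`
(stmt-ResolutionOfSingularities-19970), registered skeleton 1a77c002 (stubs
`stub_saturationFourSurfaceResidualFour`, `stub_completedStepPersistenceRationalNormal'`,
`stub_levelFourPersistenceNonnormalOrNonrational'`, `stub_localChartPersistenceSurface`).
[OURS · bookkeeping over LANDED tree lemmas; AI-written, weaker than expert review; NOT a statement of
the manuscript under study (Hironaka 2017) and no statement of that manuscript is used.]  DEF-FREE;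
every conjecture enters only as a hypothesis.

RE-BASING (§1): for an admissible datum `(A, O)` (finitely generated `A ⊆ O ⊆ K = Frac A`, `k ⊆ O`)
and any `m`, the landed tower model (`HomologicalConductorGlobalisation.stub_towerModel`, `stub_locEq`)
gives a finitely generated `A ≤ A_m ⊆ O` with `T_m = loc A_m`, again admissible of the same Krull
dimension, whose tower is the shifted tower `tower O A_m j = tower O A (m + j)`
(`exists_fg_model_tower_eq`).  CONSEQUENCES (all proved, def-free): `persistenceSurface_iff_firstStep`
(the rung ⇔ its first step `ca(loc A) ⊆ ca(T₁)` over all admissible surface data);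
`levelFourPersistenceSurface'_iff_firstStep` and `saturationFourSurfaceResidual₄_iff_firstStep` (the
level-four transfer and the registered stub (C1) ⇔ their instances `m = 0`);
`levelFourPersistenceNonnormalOrNonrational'_of_firstSteps` (the registered stub (C3′), class Σ6 ∪ Σ8
AT STAGE 0 and all steps, ⇐ `LevelFourPersistenceRationalNormal'` + FIRST-STEP transfers on (Σ6)
«`loc A` normal, not rational, not regular» and (Σ8) «`loc A` not normal» — the non-normal class costs
ONE step, every later stage being normal and stage `0` of a re-based datum);
`persistenceSurface_of_firstStepResidual₄_of_completedStep'_of_firstSteps` (door of record: the rung ⇐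
CSP‴ + three statements about the ONE step `loc A → T₁`); `persistenceSurface_of_firstStep_classes` /
`…_singularClasses` (LEVEL-FREE door: the rung ⇐ `ca(loc A) ⊆ ca(T₁)` on (R♮-singular), (Σ6), (Σ8);
no saturation hypothesis; the regular class is free).

References: res-L1-w44b-plan-1 CHAIN w44b (OURS); O. Zariski, P. Samuel, *Commutative Algebra* II,
Ch. VI §17 [`ZariskiSamuel1960`] (models of a function field along a valuation); H. Matsumura,
*Commutative Ring Theory*, Thm. 5.6 [`Matsumura1987`] (`dim = tr.deg` for affine domains).
-/

noncomputable section

-- single-problem summit: the doubled namespace component `ResolutionOfSingularities` is forced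
set_option linter.dupNamespace false

namespace Summit.ResolutionOfSingularities.ResolutionOfSingularities.Theorems.HomologicalConductor.PersistenceSurfaceFirstStep

open Summit.ResolutionOfSingularities.ResolutionOfSingularities.Theses.HomologicalConductor
open Summit.ResolutionOfSingularities.ResolutionOfSingularities.Theorems.NoZeno.Birth
open Summit.ResolutionOfSingularities.ResolutionOfSingularities.Theorems.HomologicalConductorGlobalisation
  (stub_locEq stub_chartStep stub_nrmStep stub_towerModel)
open Summit.ResolutionOfSingularities.ResolutionOfSingularities.Theorems.HomologicalConductor.PersistenceSurfaceTowerDim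
open Summit.ResolutionOfSingularities.ResolutionOfSingularities.Theorems.HomologicalConductor.PersistenceSurfaceCompletedStepLevelFree
open Summit.ResolutionOfSingularities.ResolutionOfSingularities.Theorems.HomologicalConductor.PersistenceSurfaceSaturationResidual
  (IsMonicHypersurfaceLocalization)
open Summit.ResolutionOfSingularities.ResolutionOfSingularities.Theorems.HomologicalConductor.PersistenceSurfaceSaturationResidualThree
  (IsEdimHypersurfaceCandidate)
open Summit.ResolutionOfSingularities.ResolutionOfSingularities.Theorems.HomologicalConductor.PersistenceSurfaceSaturationResidualFour
open Literature.AlgebraicGeometry.Resolution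

variable {k K : Type} [Field k] [Field K] [Algebra k K]

/-! ## §1 Re-basing the tower at a stage with a finitely generated model -/

/-- **Krull dimension of a second affine model.** Two finitely generated `k`-subalgebras of `K`
with fraction field `K` have the same Krull dimension (`= tr.deg_k K`); in particular a bound
`dim A ≤ d` passes to any other model `A'`. [cite: Matsumura1987, Thm. 5.6] -/
theorem ringKrullDim_le_of_models (A A' : Subalgebra k K) (hA : A.FG) [IsFractionRing ↥A K]
    (hA' : A'.FG) (hfr' : IsFractionRing ↥A' K) {d : ℕ} (hd : ringKrullDim ↥A ≤ d) :
    ringKrullDim ↥A' ≤ d := by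
  haveI := hfr'
  haveI : Algebra.FiniteType k ↥A' := A'.fg_iff_finiteType.mp hA'
  have htr : Algebra.trdeg k K ≤ d := trdeg_le_of_ringKrullDim_le A hA hd
  obtain ⟨n, hn, htr'⟩ := exists_ringKrullDim_eq_and_trdeg_eq k ↥A'
  rw [trdeg_eq_trdeg_of_isFractionRing A', htr'] at htr
  rw [hn]
  exact_mod_cast htr

/-- **The stage `T_m` is stage `0` of a finitely generated model, and the tower re-bases.**  For an
admissible datum `(A, O)` and every `m` there is a finitely generated `A ≤ A_m ⊆ O` with
`Frac A_m = K` whose canonical tower is the shifted tower: `tower O A_m j = tower O A (m + j)` for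
every `j` (in particular `loc A_m = T_m`).  Landed inputs: the tower model `stub_towerModel` (with
`stub_locEq`, `stub_chartStep`, `stub_nrmStep`) and `stub_locEq`. [cite: ZariskiSamuel1960, Ch. VI §17] -/
theorem exists_fg_model_tower_eq (O : ValuationSubring K) (A : Subalgebra k K)
    (hA : A.FG) (hfr : IsFractionRing ↥A K) (hAO : A.toSubring ≤ O.toSubring) (m : ℕ) :
    ∃ Am : Subalgebra k K, Am.FG ∧ A ≤ Am ∧ Am.toSubring ≤ O.toSubring ∧ IsFractionRing ↥Am K ∧
      tower O Am 0 = tower O A m ∧ tower O Am 1 = tower O A (m + 1) ∧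
      ∀ j : ℕ, tower O Am j = tower O A (m + j) := by
  have hmodel : ∃ Am : Subalgebra k K, Am.FG ∧ A ≤ Am ∧ Am.toSubring ≤ O.toSubring ∧
      (tower O A m).toSubring = locAtCentre Am.toSubring O :=
    stub_towerModel stub_locEq stub_chartStep stub_nrmStep O A hA hfr hAO m
  obtain ⟨Am, hAmfg, hAAm, hAmO, hT⟩ := hmodel
  have h0 : tower O Am 0 = tower O A m := by
    rw [tower_zero]
    exact Subalgebra.toSubring_injective ((stub_locEq O Am hAmO).trans hT.symm)
  have h1 : tower O Am 1 = tower O A (m + 1) := by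
    rw [tower_succ, h0, ← tower_succ]
  refine ⟨Am, hAmfg, hAAm, hAmO, isFractionRing_of_le hAAm hfr, h0, h1, fun j => ?_⟩
  induction j with
  | zero => simpa using h0
  | succ j ih => rw [tower_succ, ih, ← tower_succ, Nat.add_assoc]

/-! ## §2 The rung is its first step -/

/-- **`PersistenceSurface ↔ first-step persistence.**  The rung (`ca(T_m) ⊆ ca(T_(m+1))` for all
admissible surface data and all `m`) is equivalent to its instance `m = 0`
(`ca(loc A) ⊆ ca(T₁)`) over all admissible surface data: step `m` of the tower of `(A, O)` is step
`0` of the tower of the re-based model `(A_m, O)` (`exists_fg_model_tower_eq`), which is again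
admissible of Krull dimension `≤ 2` (`ringKrullDim_le_of_models`). [folklore] -/
theorem persistenceSurface_iff_firstStep :
    PersistenceSurface ↔
      ∀ p : ℕ, p.Prime → ∀ (k K : Type) [Field k] [CharP k p] [Field K] [Algebra k K]
        (O : ValuationSubring K) (A : Subalgebra k K), (∀ c : k, algebraMap k K c ∈ O) → A.FG →
        IsFractionRing ↥A K → A.toSubring ≤ O.toSubring → ringKrullDim ↥A ≤ 2 →
        ca (tower O A 0) ⊆ ca (tower O A 1) := by
  constructor
  · intro hP p hp k K _ _ _ _ O A hk hA hfr hAO hdim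
    exact hP p hp k K O A hk hA hfr hAO hdim 0
  · intro hF p hp k K _ _ _ _ O A hk hA hfr hAO hdim ca' loc' chart' nrm' tower' m
    show ca (tower O A m) ⊆ ca (tower O A (m + 1))
    haveI := hfr
    obtain ⟨Am, hAmfg, -, hAmO, hAmfr, h0, h1, -⟩ := exists_fg_model_tower_eq O A hA hfr hAO m
    have hdim' : ringKrullDim ↥Am ≤ 2 := ringKrullDim_le_of_models A Am hA hAmfg hAmfr hdim
    have h := hF p hp k K O Am hk hAmfg hAmfr hAmO hdim'
    rw [h0, h1] at h
    exact h

/-! ## §3 The level-four-source transfer is its first step, and splits by the class of the CURRENT stage -/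

/-- **`LevelFourPersistenceSurface' ↔ its first step**: `ca⁴(T_m) ⊆ ca(T_(m+1))` for all admissible
surface data and all `m` iff `ca⁴(loc A) ⊆ ca(T₁)` for all admissible surface data. [folklore] -/
theorem levelFourPersistenceSurface'_iff_firstStep :
    LevelFourPersistenceSurface' ↔
      ∀ p : ℕ, p.Prime → ∀ (k K : Type) [Field k] [CharP k p] [Field K] [Algebra k K]
        (O : ValuationSubring K) (A : Subalgebra k K), (∀ c : k, algebraMap k K c ∈ O) → A.FG →
        IsFractionRing ↥A K → A.toSubring ≤ O.toSubring → ringKrullDim ↥A ≤ 2 →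
        {x : K | ∃ hx : x ∈ tower O A 0, ∀ i : ℕ, 4 ≤ i → ∀ (M N : ModuleCat.{0} ↥(tower O A 0)),
            Module.Finite ↥(tower O A 0) M → Module.Finite ↥(tower O A 0) N →
              ∀ e : CategoryTheory.Abelian.Ext.{0} M N i, (⟨x, hx⟩ : ↥(tower O A 0)) • e = 0} ⊆
          ca (tower O A 1) := by
  constructor
  · intro hL p hp k K _ _ _ _ O A hk hA hfr hAO hdim
    exact hL p hp k K O A hk hA hfr hAO hdim 0
  · intro hF p hp k K _ _ _ _ O A hk hA hfr hAO hdim caAt' ca' loc' chart' nrm' tower' m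
    show {x : K | ∃ hx : x ∈ tower O A m, ∀ i : ℕ, 4 ≤ i → ∀ (M N : ModuleCat.{0} ↥(tower O A m)),
        Module.Finite ↥(tower O A m) M → Module.Finite ↥(tower O A m) N →
          ∀ e : CategoryTheory.Abelian.Ext.{0} M N i, (⟨x, hx⟩ : ↥(tower O A m)) • e = 0} ⊆
      ca (tower O A (m + 1))
    haveI := hfr
    obtain ⟨Am, hAmfg, -, hAmO, hAmfr, h0, h1, -⟩ := exists_fg_model_tower_eq O A hA hfr hAO m
    have hdim' : ringKrullDim ↥Am ≤ 2 := ringKrullDim_le_of_models A Am hA hAmfg hAmfr hdim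
    have h := hF p hp k K O Am hk hAmfg hAmfr hAmO hdim'
    rw [h0, h1] at h
    exact h

/-- **The level-four-source transfer from three FIRST-STEP statements split by the class of the
current stage `T₀ = loc A`**: (R♮) `T₀` normal with a rational singularity, or regular; (Σ6) `T₀`
normal, not rational, not regular; (Σ8) `T₀` not normal.  At step `m` re-base to `(A_m, O)`
(`exists_fg_model_tower_eq`) and decide the class of `T_m = loc A_m` by excluded middle. [folklore] -/
theorem levelFourPersistenceSurface'_of_firstSteps
    (hRN : ∀ p : ℕ, p.Prime → ∀ (k K : Type) [Field k] [CharP k p] [Field K] [Algebra k K]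
      (O : ValuationSubring K) (A : Subalgebra k K), (∀ c : k, algebraMap k K c ∈ O) → A.FG →
      IsFractionRing ↥A K → A.toSubring ≤ O.toSubring → ringKrullDim ↥A ≤ 2 →
      ((IsIntegrallyClosed ↥(tower O A 0) ∧
          Literature.AlgebraicGeometry.Resolution.HasRationalSingularity ↥(tower O A 0)) ∨
        IsRegularLocalRing ↥(tower O A 0)) →
      {x : K | ∃ hx : x ∈ tower O A 0, ∀ i : ℕ, 4 ≤ i → ∀ (M N : ModuleCat.{0} ↥(tower O A 0)),
          Module.Finite ↥(tower O A 0) M → Module.Finite ↥(tower O A 0) N →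
            ∀ e : CategoryTheory.Abelian.Ext.{0} M N i, (⟨x, hx⟩ : ↥(tower O A 0)) • e = 0} ⊆
        ca (tower O A 1))
    (hS6 : ∀ p : ℕ, p.Prime → ∀ (k K : Type) [Field k] [CharP k p] [Field K] [Algebra k K]
      (O : ValuationSubring K) (A : Subalgebra k K), (∀ c : k, algebraMap k K c ∈ O) → A.FG →
      IsFractionRing ↥A K → A.toSubring ≤ O.toSubring → ringKrullDim ↥A ≤ 2 →
      IsIntegrallyClosed ↥(tower O A 0) →
      ¬ Literature.AlgebraicGeometry.Resolution.HasRationalSingularity ↥(tower O A 0) →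
      ¬ IsRegularLocalRing ↥(tower O A 0) →
      {x : K | ∃ hx : x ∈ tower O A 0, ∀ i : ℕ, 4 ≤ i → ∀ (M N : ModuleCat.{0} ↥(tower O A 0)),
          Module.Finite ↥(tower O A 0) M → Module.Finite ↥(tower O A 0) N →
            ∀ e : CategoryTheory.Abelian.Ext.{0} M N i, (⟨x, hx⟩ : ↥(tower O A 0)) • e = 0} ⊆
        ca (tower O A 1))
    (hS8 : ∀ p : ℕ, p.Prime → ∀ (k K : Type) [Field k] [CharP k p] [Field K] [Algebra k K]
      (O : ValuationSubring K) (A : Subalgebra k K), (∀ c : k, algebraMap k K c ∈ O) → A.FG →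
      IsFractionRing ↥A K → A.toSubring ≤ O.toSubring → ringKrullDim ↥A ≤ 2 →
      ¬ IsIntegrallyClosed ↥(tower O A 0) →
      {x : K | ∃ hx : x ∈ tower O A 0, ∀ i : ℕ, 4 ≤ i → ∀ (M N : ModuleCat.{0} ↥(tower O A 0)),
          Module.Finite ↥(tower O A 0) M → Module.Finite ↥(tower O A 0) N →
            ∀ e : CategoryTheory.Abelian.Ext.{0} M N i, (⟨x, hx⟩ : ↥(tower O A 0)) • e = 0} ⊆
        ca (tower O A 1)) :
    LevelFourPersistenceSurface' := by
  rw [levelFourPersistenceSurface'_iff_firstStep]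
  intro p hp k K _ _ _ _ O A hk hA hfr hAO hdim
  by_cases hR : (IsIntegrallyClosed ↥(tower O A 0) ∧
      Literature.AlgebraicGeometry.Resolution.HasRationalSingularity ↥(tower O A 0)) ∨
      IsRegularLocalRing ↥(tower O A 0)
  · exact hRN p hp k K O A hk hA hfr hAO hdim hR
  · by_cases hN : IsIntegrallyClosed ↥(tower O A 0)
    · exact hS6 p hp k K O A hk hA hfr hAO hdim hN (fun h => hR (Or.inl ⟨hN, h⟩))
        (fun h => hR (Or.inr h))
    · exact hS8 p hp k K O A hk hA hfr hAO hdim hN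

/-- **The registered stub (C3′) from first steps.**  `LevelFourPersistenceNonnormalOrNonrational'`
(class Σ6 ∪ Σ8 at stage `0`, transfer at EVERY step) follows from `LevelFourPersistenceRationalNormal'`
(itself a consequence of CSP‴, `levelFourPersistenceRationalNormal'_of_completedStep'`) and the two
FIRST-STEP statements on (Σ6) and (Σ8): later stages of a Σ6 ∪ Σ8 tower are stage `0` of re-based
data, which fall in (R♮) or (Σ6) or (Σ8) again.  So the non-normal class Σ8 is ONE step deep.
[folklore] -/
theorem levelFourPersistenceNonnormalOrNonrational'_of_firstSteps
    (hR : LevelFourPersistenceRationalNormal')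
    (hS6 : ∀ p : ℕ, p.Prime → ∀ (k K : Type) [Field k] [CharP k p] [Field K] [Algebra k K]
      (O : ValuationSubring K) (A : Subalgebra k K), (∀ c : k, algebraMap k K c ∈ O) → A.FG →
      IsFractionRing ↥A K → A.toSubring ≤ O.toSubring → ringKrullDim ↥A ≤ 2 →
      IsIntegrallyClosed ↥(tower O A 0) →
      ¬ Literature.AlgebraicGeometry.Resolution.HasRationalSingularity ↥(tower O A 0) →
      ¬ IsRegularLocalRing ↥(tower O A 0) →
      {x : K | ∃ hx : x ∈ tower O A 0, ∀ i : ℕ, 4 ≤ i → ∀ (M N : ModuleCat.{0} ↥(tower O A 0)),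
          Module.Finite ↥(tower O A 0) M → Module.Finite ↥(tower O A 0) N →
            ∀ e : CategoryTheory.Abelian.Ext.{0} M N i, (⟨x, hx⟩ : ↥(tower O A 0)) • e = 0} ⊆
        ca (tower O A 1))
    (hS8 : ∀ p : ℕ, p.Prime → ∀ (k K : Type) [Field k] [CharP k p] [Field K] [Algebra k K]
      (O : ValuationSubring K) (A : Subalgebra k K), (∀ c : k, algebraMap k K c ∈ O) → A.FG →
      IsFractionRing ↥A K → A.toSubring ≤ O.toSubring → ringKrullDim ↥A ≤ 2 →
      ¬ IsIntegrallyClosed ↥(tower O A 0) →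
      {x : K | ∃ hx : x ∈ tower O A 0, ∀ i : ℕ, 4 ≤ i → ∀ (M N : ModuleCat.{0} ↥(tower O A 0)),
          Module.Finite ↥(tower O A 0) M → Module.Finite ↥(tower O A 0) N →
            ∀ e : CategoryTheory.Abelian.Ext.{0} M N i, (⟨x, hx⟩ : ↥(tower O A 0)) • e = 0} ⊆
        ca (tower O A 1)) :
    LevelFourPersistenceNonnormalOrNonrational' := by
  have hL : LevelFourPersistenceSurface' :=
    levelFourPersistenceSurface'_of_firstSteps
      (fun p hp k K _ _ _ _ O A hk hA hfr hAO hdim hclass => hR p hp k K O A hk hA hfr hAO hdim hclass 0)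
      hS6 hS8
  intro p hp k K _ _ _ _ O A hk hA hfr hAO hdim caAt' ca' loc' chart' nrm' tower' _ m
  exact hL p hp k K O A hk hA hfr hAO hdim m

/-! ## §3b The fourth saturation residual (registered stub C1) is its first step -/

/-- **`SaturationFourSurfaceResidual₄ ↔ its first step.**  The registered stub (C1) — `Sat₄`
(`ca(T_m) ⊆ ca⁴(T_m)`) at the stages `T_m` that are not regular, not monic-hypersurface
localisations, not edim-candidates, of Krull dimension `2`, with a singular successor — is equivalent
to its instance `m = 0` over all admissible surface data: `Sat₄(loc A)` for `loc A` in that class with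
`T₁` singular.  Same re-basing (`exists_fg_model_tower_eq`, `ringKrullDim_le_of_models`). [folklore] -/
theorem saturationFourSurfaceResidual₄_iff_firstStep :
    SaturationFourSurfaceResidual₄ ↔
      ∀ p : ℕ, p.Prime → ∀ (k K : Type) [Field k] [CharP k p] [Field K] [Algebra k K]
        (O : ValuationSubring K) (A : Subalgebra k K), (∀ c : k, algebraMap k K c ∈ O) → A.FG →
        IsFractionRing ↥A K → A.toSubring ≤ O.toSubring → ringKrullDim ↥A ≤ 2 →
        ¬ IsRegularLocalRing ↥(tower O A 0) → ¬ IsMonicHypersurfaceLocalization k 2 ↥(tower O A 0) →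
        ¬ IsEdimHypersurfaceCandidate 2 ↥(tower O A 0) → ¬ IsRegularLocalRing ↥(tower O A 1) →
        ringKrullDim ↥(tower O A 0) = (2 : ℕ) →
        ca (tower O A 0) ⊆
          {x : K | ∃ hx : x ∈ tower O A 0, ∀ i : ℕ, 4 ≤ i → ∀ (M N : ModuleCat.{0} ↥(tower O A 0)),
            Module.Finite ↥(tower O A 0) M → Module.Finite ↥(tower O A 0) N →
              ∀ e : CategoryTheory.Abelian.Ext.{0} M N i, (⟨x, hx⟩ : ↥(tower O A 0)) • e = 0} := by
  constructor
  · intro hS p hp k K _ _ _ _ O A hk hA hfr hAO hdim hreg hmon hcand hsucc hdim2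
    exact hS p hp k K O A hk hA hfr hAO hdim 0 hreg hmon hcand hsucc hdim2
  · intro hF p hp k K _ _ _ _ O A hk hA hfr hAO hdim caAt' ca' loc' chart' nrm' tower' m hreg hmon
      hcand hsucc hdim2
    show ca (tower O A m) ⊆
      {x : K | ∃ hx : x ∈ tower O A m, ∀ i : ℕ, 4 ≤ i → ∀ (M N : ModuleCat.{0} ↥(tower O A m)),
        Module.Finite ↥(tower O A m) M → Module.Finite ↥(tower O A m) N →
          ∀ e : CategoryTheory.Abelian.Ext.{0} M N i, (⟨x, hx⟩ : ↥(tower O A m)) • e = 0}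
    haveI := hfr
    obtain ⟨Am, hAmfg, -, hAmO, hAmfr, h0, h1, -⟩ := exists_fg_model_tower_eq O A hA hfr hAO m
    have hdim' : ringKrullDim ↥Am ≤ 2 := ringKrullDim_le_of_models A Am hA hAmfg hAmfr hdim
    have hreg' : ¬ IsRegularLocalRing ↥(tower O Am 0) := by rw [h0]; exact hreg
    have hmon' : ¬ IsMonicHypersurfaceLocalization k 2 ↥(tower O Am 0) := by rw [h0]; exact hmon
    have hcand' : ¬ IsEdimHypersurfaceCandidate 2 ↥(tower O Am 0) := by rw [h0]; exact hcand
    have hsucc' : ¬ IsRegularLocalRing ↥(tower O Am 1) := by rw [h1]; exact hsucc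
    have hdim2' : ringKrullDim ↥(tower O Am 0) = (2 : ℕ) := by rw [h0]; exact hdim2
    have h := hF p hp k K O Am hk hAmfg hAmfr hAmO hdim' hreg' hmon' hcand' hsucc' hdim2'
    rw [h0] at h
    exact h

/-! ## §4 The doors, first-step form -/

/-- **DOOR OF RECORD, ALL FIRST-STEP [OURS].**  `PersistenceSurface` (by name) from FOUR statements
about the single step `loc A → T₁` over all admissible surface data — first-step `Sat₄` on the residual
class (stub C1 by `saturationFourSurfaceResidual₄_iff_firstStep`), first-step level-four-source
transfer on (Σ6) and on (Σ8) — together with CSP‴ (stub C2, which supplies the class (R♮)).  Nothing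
is asserted; every premise is a hypothesis. [folklore] -/
theorem persistenceSurface_of_firstStepResidual₄_of_completedStep'_of_firstSteps
    (hS : ∀ p : ℕ, p.Prime → ∀ (k K : Type) [Field k] [CharP k p] [Field K] [Algebra k K]
        (O : ValuationSubring K) (A : Subalgebra k K), (∀ c : k, algebraMap k K c ∈ O) → A.FG →
        IsFractionRing ↥A K → A.toSubring ≤ O.toSubring → ringKrullDim ↥A ≤ 2 →
        ¬ IsRegularLocalRing ↥(tower O A 0) → ¬ IsMonicHypersurfaceLocalization k 2 ↥(tower O A 0) →
        ¬ IsEdimHypersurfaceCandidate 2 ↥(tower O A 0) → ¬ IsRegularLocalRing ↥(tower O A 1) →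
        ringKrullDim ↥(tower O A 0) = (2 : ℕ) →
        ca (tower O A 0) ⊆
          {x : K | ∃ hx : x ∈ tower O A 0, ∀ i : ℕ, 4 ≤ i → ∀ (M N : ModuleCat.{0} ↥(tower O A 0)),
            Module.Finite ↥(tower O A 0) M → Module.Finite ↥(tower O A 0) N →
              ∀ e : CategoryTheory.Abelian.Ext.{0} M N i, (⟨x, hx⟩ : ↥(tower O A 0)) • e = 0})
    (hC : CompletedStepPersistenceRationalNormal')
    (hS6 : ∀ p : ℕ, p.Prime → ∀ (k K : Type) [Field k] [CharP k p] [Field K] [Algebra k K]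
      (O : ValuationSubring K) (A : Subalgebra k K), (∀ c : k, algebraMap k K c ∈ O) → A.FG →
      IsFractionRing ↥A K → A.toSubring ≤ O.toSubring → ringKrullDim ↥A ≤ 2 →
      IsIntegrallyClosed ↥(tower O A 0) →
      ¬ Literature.AlgebraicGeometry.Resolution.HasRationalSingularity ↥(tower O A 0) →
      ¬ IsRegularLocalRing ↥(tower O A 0) →
      {x : K | ∃ hx : x ∈ tower O A 0, ∀ i : ℕ, 4 ≤ i → ∀ (M N : ModuleCat.{0} ↥(tower O A 0)),
          Module.Finite ↥(tower O A 0) M → Module.Finite ↥(tower O A 0) N →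
            ∀ e : CategoryTheory.Abelian.Ext.{0} M N i, (⟨x, hx⟩ : ↥(tower O A 0)) • e = 0} ⊆
        ca (tower O A 1))
    (hS8 : ∀ p : ℕ, p.Prime → ∀ (k K : Type) [Field k] [CharP k p] [Field K] [Algebra k K]
      (O : ValuationSubring K) (A : Subalgebra k K), (∀ c : k, algebraMap k K c ∈ O) → A.FG →
      IsFractionRing ↥A K → A.toSubring ≤ O.toSubring → ringKrullDim ↥A ≤ 2 →
      ¬ IsIntegrallyClosed ↥(tower O A 0) →
      {x : K | ∃ hx : x ∈ tower O A 0, ∀ i : ℕ, 4 ≤ i → ∀ (M N : ModuleCat.{0} ↥(tower O A 0)),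
          Module.Finite ↥(tower O A 0) M → Module.Finite ↥(tower O A 0) N →
            ∀ e : CategoryTheory.Abelian.Ext.{0} M N i, (⟨x, hx⟩ : ↥(tower O A 0)) • e = 0} ⊆
        ca (tower O A 1)) :
    Summit.ResolutionOfSingularities.ResolutionOfSingularities.Theses.HomologicalConductor.PersistenceSurface :=
  persistenceSurface_of_residual₄_of_completedStep'_of_rest'
    (saturationFourSurfaceResidual₄_iff_firstStep.mpr hS) hC
    (levelFourPersistenceNonnormalOrNonrational'_of_firstSteps
      (levelFourPersistenceRationalNormal'_of_completedStep' hC) hS6 hS8)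

/-- **THE LEVEL-FREE DOOR [OURS]: no saturation hypothesis.**  `PersistenceSurface` (by name) follows
from the three LEVEL-FREE FIRST-STEP statements `ca(loc A) ⊆ ca(T₁)` on the classes (R♮), (Σ6), (Σ8)
of `loc A` — `persistenceSurface_iff_firstStep` and excluded middle on the class. [folklore] -/
theorem persistenceSurface_of_firstStep_classes
    (hRN : ∀ p : ℕ, p.Prime → ∀ (k K : Type) [Field k] [CharP k p] [Field K] [Algebra k K]
      (O : ValuationSubring K) (A : Subalgebra k K), (∀ c : k, algebraMap k K c ∈ O) → A.FG →
      IsFractionRing ↥A K → A.toSubring ≤ O.toSubring → ringKrullDim ↥A ≤ 2 →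
      ((IsIntegrallyClosed ↥(tower O A 0) ∧
          Literature.AlgebraicGeometry.Resolution.HasRationalSingularity ↥(tower O A 0)) ∨
        IsRegularLocalRing ↥(tower O A 0)) →
      ca (tower O A 0) ⊆ ca (tower O A 1))
    (hS6 : ∀ p : ℕ, p.Prime → ∀ (k K : Type) [Field k] [CharP k p] [Field K] [Algebra k K]
      (O : ValuationSubring K) (A : Subalgebra k K), (∀ c : k, algebraMap k K c ∈ O) → A.FG →
      IsFractionRing ↥A K → A.toSubring ≤ O.toSubring → ringKrullDim ↥A ≤ 2 →
      IsIntegrallyClosed ↥(tower O A 0) →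
      ¬ Literature.AlgebraicGeometry.Resolution.HasRationalSingularity ↥(tower O A 0) →
      ¬ IsRegularLocalRing ↥(tower O A 0) → ca (tower O A 0) ⊆ ca (tower O A 1))
    (hS8 : ∀ p : ℕ, p.Prime → ∀ (k K : Type) [Field k] [CharP k p] [Field K] [Algebra k K]
      (O : ValuationSubring K) (A : Subalgebra k K), (∀ c : k, algebraMap k K c ∈ O) → A.FG →
      IsFractionRing ↥A K → A.toSubring ≤ O.toSubring → ringKrullDim ↥A ≤ 2 →
      ¬ IsIntegrallyClosed ↥(tower O A 0) → ca (tower O A 0) ⊆ ca (tower O A 1)) :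
    Summit.ResolutionOfSingularities.ResolutionOfSingularities.Theses.HomologicalConductor.PersistenceSurface := by
  rw [persistenceSurface_iff_firstStep]
  intro p hp k K _ _ _ _ O A hk hA hfr hAO hdim
  by_cases hR : (IsIntegrallyClosed ↥(tower O A 0) ∧
      Literature.AlgebraicGeometry.Resolution.HasRationalSingularity ↥(tower O A 0)) ∨
      IsRegularLocalRing ↥(tower O A 0)
  · exact hRN p hp k K O A hk hA hfr hAO hdim hR
  · by_cases hN : IsIntegrallyClosed ↥(tower O A 0)
    · exact hS6 p hp k K O A hk hA hfr hAO hdim hN (fun h => hR (Or.inl ⟨hN, h⟩))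
        (fun h => hR (Or.inr h))
    · exact hS8 p hp k K O A hk hA hfr hAO hdim hN

/-- **The regular class is free**: on «`loc A` regular» the first step holds outright (the tower is
stationary at a regular stage, `tower_succ_eq_self_of_isRegularLocalRing`), so the (R♮) first-step
hypothesis of `persistenceSurface_of_firstStep_classes` is only about NORMAL RATIONAL SINGULAR
`loc A`. [folklore] -/
theorem firstStep_of_isRegularLocalRing {p : ℕ} (_hp : p.Prime) [CharP k p]
    (O : ValuationSubring K) (A : Subalgebra k K) (hk : ∀ c : k, algebraMap k K c ∈ O)
    (hfr : IsFractionRing ↥A K) (hAO : A.toSubring ≤ O.toSubring)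
    (hreg : IsRegularLocalRing ↥(tower O A 0)) : ca (tower O A 0) ⊆ ca (tower O A 1) := by
  have h := tower_succ_eq_self_of_isRegularLocalRing O A hk hfr hAO 0 hreg
  rw [zero_add] at h
  rw [h]

/-- **LEVEL-FREE DOOR, singular classes only [OURS].**  `PersistenceSurface` follows from the three
level-free first-step statements on (R) «`loc A` normal, rational, NOT regular», (Σ6), (Σ8).
[folklore] -/
theorem persistenceSurface_of_firstStep_singularClasses
    (hR : ∀ p : ℕ, p.Prime → ∀ (k K : Type) [Field k] [CharP k p] [Field K] [Algebra k K]
      (O : ValuationSubring K) (A : Subalgebra k K), (∀ c : k, algebraMap k K c ∈ O) → A.FG →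
      IsFractionRing ↥A K → A.toSubring ≤ O.toSubring → ringKrullDim ↥A ≤ 2 →
      IsIntegrallyClosed ↥(tower O A 0) →
      Literature.AlgebraicGeometry.Resolution.HasRationalSingularity ↥(tower O A 0) →
      ¬ IsRegularLocalRing ↥(tower O A 0) → ca (tower O A 0) ⊆ ca (tower O A 1))
    (hS6 : ∀ p : ℕ, p.Prime → ∀ (k K : Type) [Field k] [CharP k p] [Field K] [Algebra k K]
      (O : ValuationSubring K) (A : Subalgebra k K), (∀ c : k, algebraMap k K c ∈ O) → A.FG →
      IsFractionRing ↥A K → A.toSubring ≤ O.toSubring → ringKrullDim ↥A ≤ 2 →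
      IsIntegrallyClosed ↥(tower O A 0) →
      ¬ Literature.AlgebraicGeometry.Resolution.HasRationalSingularity ↥(tower O A 0) →
      ¬ IsRegularLocalRing ↥(tower O A 0) → ca (tower O A 0) ⊆ ca (tower O A 1))
    (hS8 : ∀ p : ℕ, p.Prime → ∀ (k K : Type) [Field k] [CharP k p] [Field K] [Algebra k K]
      (O : ValuationSubring K) (A : Subalgebra k K), (∀ c : k, algebraMap k K c ∈ O) → A.FG →
      IsFractionRing ↥A K → A.toSubring ≤ O.toSubring → ringKrullDim ↥A ≤ 2 →
      ¬ IsIntegrallyClosed ↥(tower O A 0) → ca (tower O A 0) ⊆ ca (tower O A 1)) :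
    Summit.ResolutionOfSingularities.ResolutionOfSingularities.Theses.HomologicalConductor.PersistenceSurface := by
  refine persistenceSurface_of_firstStep_classes ?_ hS6 hS8
  intro p hp k K _ _ _ _ O A hk hA hfr hAO hdim hclass
  by_cases hreg : IsRegularLocalRing ↥(tower O A 0)
  · exact firstStep_of_isRegularLocalRing hp O A hk hfr hAO hreg
  · rcases hclass with ⟨hN, hrat⟩ | h
    · exact hR p hp k K O A hk hA hfr hAO hdim hN hrat hreg
    · exact absurd h hreg

end Summit.ResolutionOfSingularities.ResolutionOfSingularities.Theorems.HomologicalConductor.PersistenceSurfaceFirstStep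

end
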